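import Mathlib
import HarnessLib
import Literature.NumberTheory.Automorphic.PrincipalSeriesGL2JacquetModule
import Literature.NumberTheory.Automorphic.IwahoriGL
import Literature.LinearAlgebra.Matrix.MirabolicOrbit

/-!
# Local representation theory at conductor one, auxiliary file 1: the level `K₁(𝔭)` vector of a
# principal series `I(μ₁, μ₂)` of `GL₂(F)` with `{μ₁, μ₂} = {unramified, conductor one}`
(crux stmt-Langlands-15898 `QuarterDeficit1951.CorrespondentFingerprint`, line `Sketch`, stub
`stub_local1951_reptheory` (C3); helper `--supports`)

Let `F` be a non-archimedean local field, `B ≤ GL₂(F)` the upper Borel, `T` its Levi quotient,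
`σ` a smooth representation of `T` on `W` and `I(σ) = Ind_B^{GL₂}(σ ∘ proj ⊗ δ_B^{1/2})`
(`Representation.parabolicIndGL F id σ`).  We prove:

* `exists_subgroup_kOneP` — the compact open subgroup
  `K₁(𝔭) = {k ∈ GL₂(𝒪) : k₂₁ ∈ 𝔭, k₂₂ ∈ 1 + 𝔭}` (the inverse image of the mirabolic subgroup of
  `GL₂(𝓀)` under reduction mod `𝔭`), as a `Subgroup` with its membership criterion;
* `exists_toFun_eq_and_mem_fixedPoints_smoothIndRep` — **the standard `K`-fixed vector of an
  induced representation supported on one double coset**: for `H ≤ G`, `τ` a representation of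
  `H`, `K ≤ G` an open subgroup, `g₀ ∈ G` and `w₀ ∈ W` fixed by `τ(H ∩ g₀ K g₀⁻¹)`, the function
  `h g₀ κ ↦ τ(h) w₀` (zero off `H g₀ K`) is a `K`-fixed element of `Ind_H^G τ` with value `w₀` at
  `g₀` (Bushnell–Henniart 2006, §2.4–2.5; Casselman 1973, proof of Thm. 1);
* `exists_mem_fixedPoints_parabolicIndGL_fin_two_of_conductor_le_one` — **the new vector at
  conductor one**: if a character `χ` of `Fˣ` is trivial on `U¹ = 1 + 𝔭` and either
  `σ(proj d(u,1)) = 1`, `σ(proj d(1,u)) = χ(u)` for all units `u` (then take `g₀ = 1`), or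
  `σ(proj d(u,1)) = χ(u)`, `σ(proj d(1,u)) = 1` (then take `g₀ = w₀`, the Weyl element), the
  principal series `I(σ)` has a non-zero `K₁(𝔭)`-fixed vector (Casselman 1973, Thm. 1 for
  `π(μ₁, μ₂)`, `a(μ₁) + a(μ₂) = 1`; Schmidt 2002, §1.2, table (1)).

References: [Casselman1973] W. Casselman, *On some results of Atkin and Lehner*, Math. Ann. 201
(1973), Thm. 1 and its proof; [BushnellHenniart2006] §2.4–2.5, §9.1; [Bump1997] §4.5–4.6.
-/

set_option linter.dupNamespace false -- project-wide option (lakefile weak.linter.dupNamespace); `Summit.Langlands.Langlands` is the mandated namespace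

noncomputable section

open scoped MatrixGroups Matrix
open Literature.NumberTheory.Automorphic ValuativeRel

namespace Summit.Langlands.Langlands.Theorems.CorrespondentFingerprint

section KOneP

variable {F : Type*} [Field F] [ValuativeRel F] [TopologicalSpace F] [IsNonarchimedeanLocalField F]

/-- **The subgroup `K₁(𝔭) ≤ GL₂(F)`**: the elements of `GL₂(𝒪)` whose reduction mod `𝔭` has last
row `(0, 1)` (inverse image of the mirabolic subgroup of `GL₂(𝓀)`); it is open (it contains the
pro-`p` Iwahori subgroup). [cite: Casselman1973, Thm. 1] -/
theorem exists_subgroup_kOneP :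
    ∃ K : Subgroup (GL (Fin 2) F), IsOpen (K : Set (GL (Fin 2) F)) ∧ ∀ g : GL (Fin 2) F,
      g ∈ K ↔ g ∈ glInt 2 F ∧ valuation F ((g : Matrix (Fin 2) (Fin 2) F) 1 0) < 1 ∧
        valuation F ((g : Matrix (Fin 2) (Fin 2) F) 1 1 - 1) < 1 := by
  set K : Subgroup (GL (Fin 2) F) :=
    ((Literature.LinearAlgebra.Matrix.mirabolic 1 𝓀[F]).comap (glIntReduction 2 F)).map
      (glInt 2 F).subtype with hK_def
  have hK : ∀ g : GL (Fin 2) F, g ∈ K ↔ g ∈ glInt 2 F ∧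
      valuation F ((g : Matrix (Fin 2) (Fin 2) F) 1 0) < 1 ∧
        valuation F ((g : Matrix (Fin 2) (Fin 2) F) 1 1 - 1) < 1 := by
    intro g
    have hrow : ∀ hg : g ∈ glInt 2 F, glIntReduction 2 F ⟨g, hg⟩ ∈
        Literature.LinearAlgebra.Matrix.mirabolic 1 𝓀[F] ↔
        valuation F ((g : Matrix (Fin 2) (Fin 2) F) 1 0) < 1 ∧
          valuation F ((g : Matrix (Fin 2) (Fin 2) F) 1 1 - 1) < 1 := by
      intro hg
      rw [Literature.LinearAlgebra.Matrix.mem_mirabolic_iff_row, Fin.forall_fin_two,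
        ← glIntReduction_apply_eq_zero_iff ⟨g, hg⟩, ← glIntReduction_apply_eq_one_iff ⟨g, hg⟩]
      simp [Fin.last]
    rw [hK_def, Subgroup.mem_map]
    constructor
    · rintro ⟨g', hg', rfl⟩
      exact ⟨g'.2, (hrow g'.2).1 hg'⟩
    · rintro ⟨hg, h⟩
      exact ⟨⟨g, hg⟩, (hrow hg).2 h, rfl⟩
  refine ⟨K, ?_, hK⟩
  refine Subgroup.isOpen_mono (H₁ := proPIwahoriGL 2 F) (fun g hg => ?_) (isOpen_proPIwahoriGL 2 F)
  rw [mem_proPIwahoriGL_iff] at hg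
  exact (hK g).2 ⟨hg.1, hg.2.1 1 0 (by decide), hg.2.2 1⟩

end KOneP

/-! ### The standard `K`-fixed vector of an induced representation on one double coset -/

section DoubleCosetVector

variable {k G W : Type*} [CommRing k] [Group G] [TopologicalSpace G] [SeparatelyContinuousMul G]
  [AddCommGroup W] [Module k W] (H : Subgroup G) (τ : Representation k H W)

/-- **The `K`-fixed vector of `Ind_H^G τ` supported on `H g₀ K`.**  Let `K ≤ G` be an open
subgroup, `g₀ ∈ G`, and `w₀ ∈ W` a vector fixed by `τ(h)` for every `h ∈ H ∩ g₀ K g₀⁻¹`.  Then the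
function `f(h g₀ κ) = τ(h) w₀` (`h ∈ H`, `κ ∈ K`), `f = 0` off `H g₀ K`, is a well-defined
`K`-fixed element of the smooth induced representation `Ind_H^G τ` with `f(g₀) = w₀` (it is smooth
because it is fixed by the open subgroup `K`).  This is the standard description
`(Ind τ)^K ≅ ⊕_{H g K} W^{H ∩ g K g⁻¹}` read for a single double coset.
[cite: BushnellHenniart2006, §2.4–2.5] -/
theorem exists_toFun_eq_and_mem_fixedPoints_smoothIndRep (K : Subgroup G)
    (hK : IsOpen (K : Set G)) (g₀ : G) (w₀ : W)
    (hw₀ : ∀ h : H, g₀⁻¹ * (h : G) * g₀ ∈ K → τ h w₀ = w₀) :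
    ∃ f : Representation.SmoothInd H τ, f.toFun g₀ = w₀ ∧
      f ∈ (Representation.smoothIndRep H τ).fixedPoints K := by
  classical
  -- two ways of writing `x = h g₀ κ` give the same value `τ(h) w₀`
  have hkey : ∀ (h h' : H) (x : G), g₀⁻¹ * (h : G)⁻¹ * x ∈ K → g₀⁻¹ * (h' : G)⁻¹ * x ∈ K →
      τ h w₀ = τ h' w₀ := by
    intro h h' x hh hh'
    have hmem : g₀⁻¹ * ((h'⁻¹ * h : H) : G) * g₀ ∈ K := by
      have he : g₀⁻¹ * ((h'⁻¹ * h : H) : G) * g₀ =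
          (g₀⁻¹ * (h' : G)⁻¹ * x) * (g₀⁻¹ * (h : G)⁻¹ * x)⁻¹ := by
        rw [Subgroup.coe_mul, Subgroup.coe_inv]; group
      rw [he]
      exact K.mul_mem hh' (K.inv_mem hh)
    calc τ h w₀ = τ h' (τ (h'⁻¹ * h) w₀) := by
          rw [← Module.End.mul_apply, ← map_mul, mul_inv_cancel_left]
      _ = τ h' w₀ := by rw [hw₀ _ hmem]
  -- the function
  set Fw : G → W := fun x =>
    if hx : ∃ h : H, g₀⁻¹ * (h : G)⁻¹ * x ∈ K then τ hx.choose w₀ else 0 with hFw_def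
  have hF_of : ∀ (x : G) (h : H), g₀⁻¹ * (h : G)⁻¹ * x ∈ K → Fw x = τ h w₀ := by
    intro x h hh
    have hx : ∃ h : H, g₀⁻¹ * (h : G)⁻¹ * x ∈ K := ⟨h, hh⟩
    have h1 : Fw x = τ hx.choose w₀ := by simp only [hFw_def, dif_pos hx]
    rw [h1]
    exact hkey _ _ x hx.choose_spec hh
  have hF_not : ∀ x : G, (¬ ∃ h : H, g₀⁻¹ * (h : G)⁻¹ * x ∈ K) → Fw x = 0 := fun x hx => by
    simp only [hFw_def, dif_neg hx]
  -- left `H`-equivariance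
  have hF_left : ∀ (h : H) (x : G), Fw (h * x) = τ h (Fw x) := by
    intro h x
    by_cases hx : ∃ h₁ : H, g₀⁻¹ * (h₁ : G)⁻¹ * x ∈ K
    · obtain ⟨h₁, hh₁⟩ := hx
      have hh₂ : g₀⁻¹ * ((h * h₁ : H) : G)⁻¹ * ((h : G) * x) ∈ K := by
        rwa [Subgroup.coe_mul, mul_inv_rev, show g₀⁻¹ * ((h₁ : G)⁻¹ * (h : G)⁻¹) * ((h : G) * x) =
          g₀⁻¹ * (h₁ : G)⁻¹ * x by group]
      rw [hF_of _ _ hh₂, hF_of _ _ hh₁, map_mul, Module.End.mul_apply]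
    · have hx' : ¬ ∃ h₁ : H, g₀⁻¹ * (h₁ : G)⁻¹ * ((h : G) * x) ∈ K := by
        rintro ⟨h₁, hh₁⟩
        refine hx ⟨h⁻¹ * h₁, ?_⟩
        rwa [Subgroup.coe_mul, Subgroup.coe_inv, mul_inv_rev, inv_inv,
          show g₀⁻¹ * ((h₁ : G)⁻¹ * (h : G)) * x = g₀⁻¹ * (h₁ : G)⁻¹ * ((h : G) * x) by group]
      rw [hF_not _ hx, hF_not _ hx', map_zero]
  -- right `K`-invariance
  have hF_right : ∀ (x κ : G), κ ∈ K → Fw (x * κ) = Fw x := by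
    intro x κ hκ
    by_cases hx : ∃ h₁ : H, g₀⁻¹ * (h₁ : G)⁻¹ * x ∈ K
    · obtain ⟨h₁, hh₁⟩ := hx
      have hh₂ : g₀⁻¹ * (h₁ : G)⁻¹ * (x * κ) ∈ K := by
        rw [show g₀⁻¹ * (h₁ : G)⁻¹ * (x * κ) = (g₀⁻¹ * (h₁ : G)⁻¹ * x) * κ by group]
        exact K.mul_mem hh₁ hκ
      rw [hF_of _ _ hh₂, hF_of _ _ hh₁]
    · have hx' : ¬ ∃ h₁ : H, g₀⁻¹ * (h₁ : G)⁻¹ * (x * κ) ∈ K := by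
        rintro ⟨h₁, hh₁⟩
        refine hx ⟨h₁, ?_⟩
        have h2 := K.mul_mem hh₁ (K.inv_mem hκ)
        rwa [show g₀⁻¹ * (h₁ : G)⁻¹ * (x * κ) * κ⁻¹ = g₀⁻¹ * (h₁ : G)⁻¹ * x by group] at h2
      rw [hF_not _ hx, hF_not _ hx']
  have hF_g₀ : Fw g₀ = w₀ := by
    rw [hF_of g₀ 1 (by rw [Subgroup.coe_one, inv_one, mul_one, inv_mul_cancel]; exact K.one_mem),
      map_one, Module.End.one_apply]
  -- `Fw ∈ Ind`, `K`-fixed, hence smooth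
  have hF_mem : Fw ∈ Representation.coindV H.subtype τ :=
    (Representation.mem_indFun_iff H τ _).2 fun h x => hF_left h x
  have hF_fix : (⟨Fw, hF_mem⟩ : Representation.coindV H.subtype τ) ∈
      (Representation.indFun H τ).fixedPoints K := by
    rw [Representation.mem_fixedPoints]
    intro κ hκ
    refine Subtype.ext (funext fun x => ?_)
    exact hF_right x κ hκ
  have hF_smooth : (Representation.indFun H τ).IsSmoothVector
      (⟨Fw, hF_mem⟩ : Representation.coindV H.subtype τ) :=
    (Representation.indFun H τ).isSmoothVector_of_mem_fixedPoints hK hF_fix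
  let f₀ : Representation.SmoothInd H τ :=
    show ↥(Representation.smoothInd H τ).toSubmodule from ⟨⟨Fw, hF_mem⟩, hF_smooth⟩
  have hf₀ : ∀ x, f₀.toFun x = Fw x := fun _ => rfl
  refine ⟨f₀, by rw [hf₀, hF_g₀], ?_⟩
  rw [Representation.mem_fixedPoints]
  intro κ hκ
  refine Representation.SmoothInd.ext (funext fun x => ?_)
  rw [Representation.toFun_smoothIndRep_apply, hf₀, hf₀]
  exact hF_right x κ hκ

end DoubleCosetVector

/-! ### The `K₁(𝔭)`-fixed vector of a principal series of conductor one -/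

section PrincipalSeries

variable {F : Type*} [Field F] [ValuativeRel F] [TopologicalSpace F] [IsNonarchimedeanLocalField F]
  {W : Type*} [AddCommGroup W] [Module ℂ W]
  (σ : Representation ℂ (Π a, GL {i // (id : Fin 2 → Fin 2) i = a} F) W)

omit [TopologicalSpace F] [IsNonarchimedeanLocalField F] in
/-- `σ(proj p) = σ(proj d(p₀₀, 1)) ∘ σ(proj d(1, p₁₁))` for `p ∈ B ∩ GL₂(𝒪)` (the Levi projection of
the Borel only sees the diagonal, whose entries are units). [folklore] -/
theorem apply_leviProjection_eq_diag_of_mem_glInt (p : ↥(standardParabolicGL F (id : Fin 2 → Fin 2)))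
    (hp : (p : GL (Fin 2) F) ∈ glInt 2 F) :
    ∃ a d : Fˣ, valuation F (a : F) = 1 ∧ valuation F (d : F) = 1 ∧
      (a : F) = ((p : GL (Fin 2) F) : Matrix (Fin 2) (Fin 2) F) 0 0 ∧
      (d : F) = ((p : GL (Fin 2) F) : Matrix (Fin 2) (Fin 2) F) 1 1 ∧ ∀ w : W,
      σ (leviProjection F (id : Fin 2 → Fin 2) p) w =
        σ (leviProjection F (id : Fin 2 → Fin 2) ⟨diagGL2 a 1, diagGL2_mem_standardParabolicGL_fin_two a 1⟩)
          (σ (leviProjection F (id : Fin 2 → Fin 2) ⟨diagGL2 1 d, diagGL2_mem_standardParabolicGL_fin_two 1 d⟩) w) := by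
  have hv0 := valuation_apply_eq_one_of_mem_glInt p hp 0
  have hv1 := valuation_apply_eq_one_of_mem_glInt p hp 1
  have hne0 : ((p : GL (Fin 2) F) : Matrix (Fin 2) (Fin 2) F) 0 0 ≠ 0 := fun h => by
    rw [h, map_zero] at hv0; exact zero_ne_one hv0
  have hne1 : ((p : GL (Fin 2) F) : Matrix (Fin 2) (Fin 2) F) 1 1 ≠ 0 := fun h => by
    rw [h, map_zero] at hv1; exact zero_ne_one hv1
  refine ⟨Units.mk0 _ hne0, Units.mk0 _ hne1, hv0, hv1, rfl, rfl, fun w => ?_⟩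
  rw [leviProjection_eq_leviProjection_diagGL2 p hne0 hne1]
  have hsplit : (⟨diagGL2 (Units.mk0 _ hne0) (Units.mk0 _ hne1), diagGL2_mem_standardParabolicGL_fin_two _ _⟩ :
      ↥(standardParabolicGL F (id : Fin 2 → Fin 2))) =
      ⟨diagGL2 (Units.mk0 _ hne0) 1, diagGL2_mem_standardParabolicGL_fin_two _ _⟩ *
        ⟨diagGL2 1 (Units.mk0 _ hne1), diagGL2_mem_standardParabolicGL_fin_two _ _⟩ := by
    refine Subtype.ext ?_
    change diagGL2 _ _ = diagGL2 _ _ * diagGL2 _ _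
    rw [← diagGL2_mul, mul_one, one_mul]
  rw [hsplit, map_mul, map_mul, Module.End.mul_apply]

/-- **The new vector of a principal series of `GL₂(F)` of conductor one.**  Let `K₁(𝔭)` be the
subgroup `{k ∈ GL₂(𝒪) : k₂₁ ∈ 𝔭, k₂₂ ∈ 1 + 𝔭}` and `χ : Fˣ → ℂˣ` a character trivial on
`U¹ = 1 + 𝔭`.  Suppose that on the non-zero vector `w₀ ∈ W` either (I) `σ(proj d(u,1)) w₀ = w₀` and
`σ(proj d(1,u)) w₀ = χ(u) w₀` for all units `u` (exponents `(unramified, conductor ≤ 1)`), or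
(II) `σ(proj d(u,1)) w₀ = χ(u) w₀` and `σ(proj d(1,u)) w₀ = w₀` (exponents
`(conductor ≤ 1, unramified)`).  Then `I(σ) = Ind_B(σ ∘ proj ⊗ δ^{1/2})` has a non-zero
`K₁(𝔭)`-fixed vector: in case (I) the function supported on `B K₁(𝔭)` with `f(b k) =
(σ∘proj ⊗ δ^{1/2})(b) w₀` — well defined since `B ∩ K₁(𝔭) = {(a *; 0 d) : a ∈ 𝒪ˣ, d ∈ 1 + 𝔭}`
acts trivially on `w₀` (`δ^{1/2} = 1` on `B ∩ GL₂(𝒪)`); in case (II) the function supported on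
`B w₀ K₁(𝔭)` (`w₀` the Weyl element), since `B ∩ w₀ K₁(𝔭) w₀⁻¹ = {(a *; 0 d) : a ∈ 1 + 𝔭, d ∈ 𝒪ˣ}`.
(Casselman 1973, Thm. 1 and its proof for `π(μ₁, μ₂)` with `a(μ₁) + a(μ₂) = 1`.)
[cite: Casselman1973, Thm. 1] -/
theorem exists_mem_fixedPoints_parabolicIndGL_fin_two_of_conductor_le_one
    (K : Subgroup (GL (Fin 2) F)) (hKo : IsOpen (K : Set (GL (Fin 2) F)))
    (hK : ∀ g : GL (Fin 2) F, g ∈ K ↔ g ∈ glInt 2 F ∧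
      valuation F ((g : Matrix (Fin 2) (Fin 2) F) 1 0) < 1 ∧
        valuation F ((g : Matrix (Fin 2) (Fin 2) F) 1 1 - 1) < 1)
    (χ : Fˣ →* ℂˣ) (hχ1 : ∀ u : Fˣ, valuation F ((u : F) - 1) < 1 → χ u = 1)
    {w₀ : W} (hw₀ : w₀ ≠ 0)
    (h : (∀ u : Fˣ, valuation F (u : F) = 1 →
        σ (leviProjection F (id : Fin 2 → Fin 2) ⟨diagGL2 u 1, diagGL2_mem_standardParabolicGL_fin_two u 1⟩) w₀ = w₀ ∧
        σ (leviProjection F (id : Fin 2 → Fin 2) ⟨diagGL2 1 u, diagGL2_mem_standardParabolicGL_fin_two 1 u⟩) w₀ =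
          ((χ u : ℂˣ) : ℂ) • w₀) ∨
      (∀ u : Fˣ, valuation F (u : F) = 1 →
        σ (leviProjection F (id : Fin 2 → Fin 2) ⟨diagGL2 u 1, diagGL2_mem_standardParabolicGL_fin_two u 1⟩) w₀ =
          ((χ u : ℂˣ) : ℂ) • w₀ ∧
        σ (leviProjection F (id : Fin 2 → Fin 2) ⟨diagGL2 1 u, diagGL2_mem_standardParabolicGL_fin_two 1 u⟩) w₀ = w₀)) :
    ∃ f : Representation.SmoothInd (standardParabolicGL F (id : Fin 2 → Fin 2))
        (Representation.twist (MonoidHom.comp σ (leviProjection F (id : Fin 2 → Fin 2)))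
          (rootDeltaChar (standardParabolicGL F (id : Fin 2 → Fin 2)))),
      f ≠ 0 ∧ f ∈ (Representation.parabolicIndGL F (id : Fin 2 → Fin 2) σ).fixedPoints K := by
  -- `τ(p) w₀ = σ(proj d(p₀₀,1)) (σ(proj d(1,p₁₁)) w₀)` for `p ∈ B ∩ GL₂(𝒪)`
  have hτ : ∀ p : ↥(standardParabolicGL F (id : Fin 2 → Fin 2)), (p : GL (Fin 2) F) ∈ glInt 2 F →
      ∃ a d : Fˣ, valuation F (a : F) = 1 ∧ valuation F (d : F) = 1 ∧
        (a : F) = ((p : GL (Fin 2) F) : Matrix (Fin 2) (Fin 2) F) 0 0 ∧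
        (d : F) = ((p : GL (Fin 2) F) : Matrix (Fin 2) (Fin 2) F) 1 1 ∧
        (Representation.twist (MonoidHom.comp σ (leviProjection F (id : Fin 2 → Fin 2)))
          (rootDeltaChar (standardParabolicGL F (id : Fin 2 → Fin 2)))) p w₀ =
        σ (leviProjection F (id : Fin 2 → Fin 2) ⟨diagGL2 a 1, diagGL2_mem_standardParabolicGL_fin_two a 1⟩)
          (σ (leviProjection F (id : Fin 2 → Fin 2) ⟨diagGL2 1 d, diagGL2_mem_standardParabolicGL_fin_two 1 d⟩) w₀) := by
    intro p hp
    obtain ⟨a, d, ha, hd, ha', hd', hw⟩ := apply_leviProjection_eq_diag_of_mem_glInt σ p hp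
    refine ⟨a, d, ha, hd, ha', hd', ?_⟩
    rw [Representation.twist_apply, rootDeltaChar_standardParabolicGL_eq_one_of_mem_glInt p hp,
      Units.val_one, one_smul, MonoidHom.comp_apply, hw]
  have key : ∀ (g₀ : GL (Fin 2) F),
      (∀ p : ↥(standardParabolicGL F (id : Fin 2 → Fin 2)), g₀⁻¹ * (p : GL (Fin 2) F) * g₀ ∈ K →
        (Representation.twist (MonoidHom.comp σ (leviProjection F (id : Fin 2 → Fin 2)))
          (rootDeltaChar (standardParabolicGL F (id : Fin 2 → Fin 2)))) p w₀ = w₀) →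
      ∃ f : Representation.SmoothInd (standardParabolicGL F (id : Fin 2 → Fin 2))
          (Representation.twist (MonoidHom.comp σ (leviProjection F (id : Fin 2 → Fin 2)))
            (rootDeltaChar (standardParabolicGL F (id : Fin 2 → Fin 2)))),
        f ≠ 0 ∧ f ∈ (Representation.parabolicIndGL F (id : Fin 2 → Fin 2) σ).fixedPoints K := by
    intro g₀ hg₀
    obtain ⟨f, hf, hfK⟩ := exists_toFun_eq_and_mem_fixedPoints_smoothIndRep
      (standardParabolicGL F (id : Fin 2 → Fin 2)) _ K hKo g₀ w₀ hg₀
    refine ⟨f, fun h0 => hw₀ ?_, hfK⟩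
    rw [← hf, h0]
    rfl
  rcases h with hI | hII
  · -- case (I): support `B K₁(𝔭)`
    refine key 1 fun p hp => ?_
    rw [inv_one, one_mul, mul_one] at hp
    obtain ⟨hpint, -, hp11⟩ := (hK _).1 hp
    obtain ⟨a, d, ha, hd, -, hd', hw⟩ := hτ p hpint
    rw [hw, (hI d hd).2, map_smul, (hI a ha).1, hχ1 d (by rw [hd']; exact hp11), Units.val_one,
      one_smul]
  · -- case (II): support `B w₀ K₁(𝔭)`
    refine key (permGL Fin.revPerm)⁻¹ fun p hp => ?_
    rw [inv_inv] at hp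
    obtain ⟨hpint', hp10, hp11⟩ := (hK _).1 hp
    have h0 : (Fin.revPerm : Equiv.Perm (Fin 2)) 0 = 1 := by decide
    have h1 : (Fin.revPerm : Equiv.Perm (Fin 2)) 1 = 0 := by decide
    rw [coe_permGL_mul_mul_inv, Matrix.submatrix_apply, h1] at hp11
    have hpint : (p : GL (Fin 2) F) ∈ glInt 2 F := by
      have h2 := Subgroup.mul_mem _ (Subgroup.mul_mem _ (Subgroup.inv_mem _
        (permGL_mem_glInt (F := F) (n := 2) Fin.revPerm)) hpint')
        (permGL_mem_glInt (F := F) (n := 2) Fin.revPerm)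
      have h3 : (p : GL (Fin 2) F) = (permGL Fin.revPerm : GL (Fin 2) F)⁻¹ *
          (permGL Fin.revPerm * (p : GL (Fin 2) F) * (permGL Fin.revPerm)⁻¹) * permGL Fin.revPerm := by
        group
      rw [h3]
      exact h2
    obtain ⟨a, d, ha, hd, ha', -, hw⟩ := hτ p hpint
    rw [hw, (hII d hd).2, (hII a ha).1, hχ1 a (by rw [ha']; exact hp11), Units.val_one, one_smul]

end PrincipalSeries

/-- **Registered sub-goal `stub_local1951_reptheory_newvector` (closed form of
`exists_mem_fixedPoints_parabolicIndGL_fin_two_of_conductor_le_one`)**: the principal series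
`I(σ)` of `GL₂(F)` whose exponents on `𝒪ˣ` are `{1, χ}` (in either order), `χ` trivial on
`1 + 𝔭`, has a non-zero vector fixed by `K₁(𝔭) = {k ∈ GL₂(𝒪) : |k₂₁| < 1, |k₂₂ - 1| < 1}`.
[cite: Casselman1973, Thm. 1] -/
theorem stub_local1951_reptheory_newvector : ∀ (F : Type) [Field F] [ValuativeRel F] [TopologicalSpace F] [IsNonarchimedeanLocalField F] (W : Type) [AddCommGroup W] [Module ℂ W] (σ : Representation ℂ (Π a, GL {i // (id : Fin 2 → Fin 2) i = a} F) W) (χ : Fˣ →* ℂˣ), (∀ u : Fˣ, valuation F ((u : F) - 1) < 1 → χ u = 1) → ∀ (w₀ : W), w₀ ≠ 0 → ((∀ u : Fˣ, valuation F (u : F) = 1 → σ (leviProjection F (id : Fin 2 → Fin 2) ⟨diagGL2 u 1, diagGL2_mem_standardParabolicGL_fin_two u 1⟩) w₀ = w₀ ∧ σ (leviProjection F (id : Fin 2 → Fin 2) ⟨diagGL2 1 u, diagGL2_mem_standardParabolicGL_fin_two 1 u⟩) w₀ = ((χ u : ℂˣ) : ℂ) • w₀) ∨ (∀ u : Fˣ,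 valuation F (u : F) = 1 → σ (leviProjection F (id : Fin 2 → Fin 2) ⟨diagGL2 u 1, diagGL2_mem_standardParabolicGL_fin_two u 1⟩) w₀ = ((χ u : ℂˣ) : ℂ) • w₀ ∧ σ (leviProjection F (id : Fin 2 → Fin 2) ⟨diagGL2 1 u, diagGL2_mem_standardParabolicGL_fin_two 1 u⟩) w₀ = w₀)) → ∃ f : Representation.SmoothInd (standardParabolicGL F (id : Fin 2 → Fin 2)) (Representation.twist (MonoidHom.comp σ (leviProjection F (id : Fin 2 → Fin 2))) (rootDeltaChar (standardParabolicGL F (id : Fin 2 → Fin 2)))), f ≠ 0 ∧ ∀ k : GL (Fin 2) F, k ∈ glInt 2 F → valuation F ((k : Matrix (Fin 2) (Fin 2) F) 1 0) < 1 → valuation F ((k : Matrix (Fin 2) (Fin 2) F) 1 1 - 1) < 1 → Representation.parabolicIndGL F (id : Fin 2 → Fin 2) σ k f = f := by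
  intro F _ _ _ _ W _ _ σ χ hχ1 w₀ hw₀ h
  obtain ⟨K, hKo, hK⟩ := exists_subgroup_kOneP (F := F)
  obtain ⟨f, hf0, hfK⟩ :=
    exists_mem_fixedPoints_parabolicIndGL_fin_two_of_conductor_le_one σ K hKo hK χ hχ1 hw₀ h
  refine ⟨f, hf0, fun k hk hk10 hk11 => ?_⟩
  exact ((Representation.parabolicIndGL F (id : Fin 2 → Fin 2) σ).mem_fixedPoints K f).1 hfK k
    ((hK k).2 ⟨hk, hk10, hk11⟩)

end Summit.Langlands.Langlands.Theorems.CorrespondentFingerprint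

end
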